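import Literature.MathematicalPhysics.QuantumManyBody.CubicTrialVector
import Literature.MathematicalPhysics.QuantumManyBody.BogoliubovExpansion
import HarnessLib

/-!
# Cubic expectations of the cubic trial vector: `∑ f(i,j,k)⟨ξ_ν, a†_ia†_ja†_kξ_ν⟩` as a sum over
# triples, freeing, and the coincidence bound for the cutoff error

Topic `Literature/MathematicalPhysics/QuantumManyBody`, namespace `BoseGas.Fock`; theorem-only sequel
of `CubicTrialVector.lean` (the cubic vector `ξ_ν = cubicVector e PH PS κ`, the triple contraction
`fockInner_cubicVector_X_mul_X_mul_X_mul`, its freed form `sum_mul_fockInner_cubicVector_create` and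
the swap `sum_norm_mul_defect_eq`) and of `BogoliubovExpansion.lean` (graded vanishing), for the
provefact `Literature.MathematicalPhysics.QuantumManyBody.BoseGas.BastiCenatiempoSchlein2021_upperBound`
(§4 and §5.2 of [BastiCenatiempoSchlein2021]: the expectations of the cubic operators `𝒞_N`, `F₁`,
`F₂`, `F₃` in `ξ_ν`, their main terms `I` and cutoff errors `J`).

* **Every cubic expectation lives on the triples** (`sum_mul_cubicExp_eq_sum_triples`): for any
  coefficient `f`, `∑_{i,j,k} f(i,j,k) ⟨ξ_ν, X_iX_jX_kξ_ν⟩ = ∑_τ f̃(τ) ⟨ξ_ν, X_uX_aX_bξ_ν⟩` with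
  `f̃(τ)` the sum of `f` over the six arrangements of the slots `(u,a,b)` of `τ` — a created mode
  outside `P_H ∪ P_S` is never annihilated (`cubicExp_eq_zero_of_not_mem`), the `P_H/P_S` count
  `(1,1,-2)` and the total momentum are conserved (`cubicExp_eq_zero_of_weight_ne`,
  `cubicExp_eq_zero_of_momentum_ne`), and a repeated hard mode is excluded by the squarefree
  occupations (`cubicExp_eq_zero_of_eq`). This is why "`ξ_ν` is a superposition of vectors with
  `2m` particles with momenta in `P_H` and `m` particles with momenta in `P_S`" reduces
  `⟨ξ_ν, 𝒢^{(3)}_Nξ_ν⟩` to `⟨ξ_ν, 𝒞_Nξ_ν⟩ + ∑_j⟨ξ_ν, F_jξ_ν⟩ + h.c.` [ibid., §4].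
* **Freed form and crude bound** (`sum_mul_cubicExp_eq_freed`, `norm_sum_mul_cubicExp_le`):
  `= (∑_τ f̃_τ conj κ_τ)‖ξ_ν‖² - ∑_τ f̃_τ conj(κ_τ) D_τ`, and `|·| ≤ 2(∑_τ|f̃_τκ_τ|)‖ξ_ν‖²`
  (enough for `F₁, F₂, F₃`).
* **Coincidences** (`TripleAdm.coincidence_of_incompatible`): a triple `τ` incompatible with an
  admissible `S` (`τ ∈ S` or `¬θ(S ∪ τ)`) is in a two-index coincidence with one triple of `S` or in a
  three-index coincidence with two of them — the list (5.15) of [ibid.] (`|θ_m - 1| ≤ …`) — whence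
  the **coincidence bound for the cutoff error** (`sum_mul_defect_le`):
  `∑_τ |g_τ| D_τ ≤ (F₁ K₁ + F₂ K₁²) ‖ξ_ν‖²`, `K₁ = ∑|κ|²`, with `F₁`, `F₂` the suprema of the
  two- and three-index coincidence sums of `|g|` (the quantities bounded in (5.16)–(5.17), `X₁`,
  `X₂`, by lattice sums).

## References

* [BastiCenatiempoSchlein2021] G. Basti, S. Cenatiempo, B. Schlein, Forum Math. Sigma 9 (2021) e74,
  arXiv:2101.06222: §4 (`𝒢^{(3)}_N`), §5.2 (5.8)–(5.17).
-/

noncomputable section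

namespace Literature.MathematicalPhysics.QuantumManyBody.BoseGas

open Complex MvPolynomial Finset
open scoped ComplexConjugate BigOperators

namespace Fock

variable {ι : Type*} [DecidableEq ι] [LinearOrder ι] {e : ι → Momentum} {PH PS : Finset ι}

/-! ### Vanishing of cubic expectations off the triples -/

section Vanishing

variable [Fintype ι]

/-- **Squarefree**: `a_xa_xξ_ν = 0`. [cite: BastiCenatiempoSchlein2021, after (2.15) (at most one particle per mode)] -/
theorem pderiv_pderiv_self_cubicVector (hHS : Disjoint PH PS) (κ : Triple e PH PS → ℂ) (x : ι) :
    pderiv x (pderiv x (cubicVector e PH PS κ)) = 0 := by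
  classical
  unfold cubicVector setVector
  simp only [map_sum, pderiv_monomial]
  refine Finset.sum_eq_zero fun S _ => ?_
  by_cases hA : TripleAdm e S
  · have h1 := hA.setOcc_le_one hHS x
    have h0 : ((setOcc Triple.u Triple.a Triple.b S - Finsupp.single x 1 : ι →₀ ℕ) x : ℂ) = 0 := by
      rw [Finsupp.tsub_apply, Finsupp.single_eq_same]
      norm_cast
      omega
    rw [h0, mul_zero, map_zero]
  · rw [setCoeff_of_not hA, zero_mul, zero_mul, map_zero]

/-- The cubic expectation is symmetric in the created modes (first two). [folklore] -/
theorem cubicExp_swap₁₂ (κ : Triple e PH PS → ℂ) (i j k : ι) :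
    fockInner (cubicVector e PH PS κ) (X i * (X j * (X k * cubicVector e PH PS κ))) =
      fockInner (cubicVector e PH PS κ) (X j * (X i * (X k * cubicVector e PH PS κ))) := by
  rw [← mul_assoc, mul_comm (X i), mul_assoc]

/-- The cubic expectation is symmetric in the created modes (last two). [folklore] -/
theorem cubicExp_swap₂₃ (κ : Triple e PH PS → ℂ) (i j k : ι) :
    fockInner (cubicVector e PH PS κ) (X i * (X j * (X k * cubicVector e PH PS κ))) =
      fockInner (cubicVector e PH PS κ) (X i * (X k * (X j * cubicVector e PH PS κ))) := by
  rw [← mul_assoc (X j), mul_comm (X j), mul_assoc]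

/-- **A created mode outside `P_H ∪ P_S` is never annihilated**: `⟨ξ_ν, X_iX_jX_kξ_ν⟩ = 0` if
`i ∉ P_H ∪ P_S`. [cite: BastiCenatiempoSchlein2021, §4 (`a_pξ_ν = 0` for `p ∉ P_S ∪ P_H`)] -/
theorem cubicExp_eq_zero_of_not_mem (κ : Triple e PH PS → ℂ) {i : ι} (hiH : i ∉ PH) (hiS : i ∉ PS)
    (j k : ι) : fockInner (cubicVector e PH PS κ) (X i * (X j * (X k * cubicVector e PH PS κ))) = 0 := by
  rw [fockInner_X_mul_right, pderiv_cubicVector_eq_zero κ hiH hiS, fockInner_zero_left]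

/-- **A repeated created mode is excluded**: `⟨ξ_ν, X_iX_iX_kξ_ν⟩ = 0`.
[cite: BastiCenatiempoSchlein2021, after (2.15)] -/
theorem cubicExp_eq_zero_of_eq (hHS : Disjoint PH PS) (κ : Triple e PH PS → ℂ) (i k : ι) :
    fockInner (cubicVector e PH PS κ) (X i * (X i * (X k * cubicVector e PH PS κ))) = 0 := by
  rw [fockInner_X_mul_right, fockInner_X_mul_right, pderiv_pderiv_self_cubicVector hHS, fockInner_zero_left]

/-- **Weight conservation**: for an additive weight vanishing on the triples,
`⟨ξ_ν, X_iX_jX_kξ_ν⟩ = 0` unless `w i + w j + w k = 0`. [cite: BastiCenatiempoSchlein2021, §4] -/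
theorem cubicExp_eq_zero_of_weight_ne {M : Type*} [AddCommGroup M] (κ : Triple e PH PS → ℂ)
    (w : ι → M) (hw : ∀ τ : Triple e PH PS, w τ.u + w τ.a + w τ.b = 0) {i j k : ι}
    (h : w i + w j + w k ≠ 0) :
    fockInner (cubicVector e PH PS κ) (X i * (X j * (X k * cubicVector e PH PS κ))) = 0 := by
  have hξ := isWeightedHomogeneous_cubicVector κ w hw
  have h3 : IsWeightedHomogeneous w (X i * (X j * (X k * cubicVector e PH PS κ))) (w i + (w j + (w k + 0))) :=
    isWeightedHomogeneous_X_mul' (isWeightedHomogeneous_X_mul' (isWeightedHomogeneous_X_mul' hξ k) j) i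
  refine fockInner_eq_zero_of_isWeightedHomogeneous_ne hξ h3 ?_
  intro h0
  apply h
  have : w i + (w j + (w k + 0)) = 0 := h0.symm
  rw [add_zero, ← add_assoc] at this
  exact this

/-- **Momentum conservation**: `⟨ξ_ν, X_iX_jX_kξ_ν⟩ = 0` unless `e i + e j + e k = 0`.
[cite: BastiCenatiempoSchlein2021, §4] -/
theorem cubicExp_eq_zero_of_momentum_ne (κ : Triple e PH PS → ℂ) {i j k : ι} (h : e i + e j + e k ≠ 0) :
    fockInner (cubicVector e PH PS κ) (X i * (X j * (X k * cubicVector e PH PS κ))) = 0 :=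
  cubicExp_eq_zero_of_weight_ne κ e (fun τ => τ.prop.2.2.2.1) h

omit [Fintype ι] in
/-- The `P_H/P_S` counting weight: `1` on `P_H`, `-2` on `P_S`, `0` elsewhere. It vanishes on the
triples. [cite: BastiCenatiempoSchlein2021, §4 ("`2m` particles with momenta in `P_H` and `m`
particles with momenta in `P_S`")] -/
theorem hsWeight_triple (hHS : Disjoint PH PS) (τ : Triple e PH PS) :
    (fun i : ι => if i ∈ PH then (1 : ℤ) else if i ∈ PS then -2 else 0) τ.u +
      (fun i : ι => if i ∈ PH then (1 : ℤ) else if i ∈ PS then -2 else 0) τ.a +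
      (fun i : ι => if i ∈ PH then (1 : ℤ) else if i ∈ PS then -2 else 0) τ.b = 0 := by
  have hp := τ.prop
  have hbH : τ.b ∉ PH := fun h => Finset.disjoint_left.1 hHS h hp.2.2.1
  simp only [hp.1, hp.2.1, hbH, hp.2.2.1, if_true, if_false]
  norm_num

end Vanishing

omit [DecidableEq ι] [LinearOrder ι] in
/-- Moving a fourth sum with fixed range in front of three. [folklore] -/
theorem sum_comm₃₁ {α γ M : Type*} [AddCommMonoid M] (A : Finset α) (E : Finset γ) (g : α → α → α → γ → M) :
    ∑ i ∈ A, ∑ j ∈ A, ∑ k ∈ A, ∑ t ∈ E, g i j k t = ∑ t ∈ E, ∑ i ∈ A, ∑ j ∈ A, ∑ k ∈ A, g i j k t := by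
  calc ∑ i ∈ A, ∑ j ∈ A, ∑ k ∈ A, ∑ t ∈ E, g i j k t
      = ∑ q ∈ A ×ˢ A ×ˢ A, ∑ t ∈ E, g q.1 q.2.1 q.2.2 t := by simp only [Finset.sum_product]
    _ = ∑ t ∈ E, ∑ q ∈ A ×ˢ A ×ˢ A, g q.1 q.2.1 q.2.2 t := Finset.sum_comm
    _ = _ := by simp only [Finset.sum_product]

/-! ### The arrangements of a triple and the reindexing of cubic sums -/

section Arrangements

variable [Fintype ι]

omit [DecidableEq ι] [Fintype ι] in
/-- A triple is determined by its set of modes (`P_H ∩ P_S = ∅`). [folklore] -/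
theorem Triple.eq_of_modes (hHS : Disjoint PH PS) {τ τ' : Triple e PH PS}
    (hu : τ'.u = τ.u ∨ τ'.u = τ.a ∨ τ'.u = τ.b) (ha : τ'.a = τ.u ∨ τ'.a = τ.a ∨ τ'.a = τ.b)
    (hb : τ'.b = τ.u ∨ τ'.b = τ.a ∨ τ'.b = τ.b) : τ' = τ := by
  have p := τ.prop; have p' := τ'.prop
  have hbb : τ'.b = τ.b := by
    rcases hb with h | h | h
    · exact absurd (h ▸ p'.2.2.1) (Finset.disjoint_left.1 hHS p.1)
    · exact absurd (h ▸ p'.2.2.1) (Finset.disjoint_left.1 hHS p.2.1)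
    · exact h
  have hu' : τ'.u = τ.u ∨ τ'.u = τ.a := by
    rcases hu with h | h | h
    · exact Or.inl h
    · exact Or.inr h
    · exact absurd (h ▸ p'.1) (fun hh => Finset.disjoint_left.1 hHS hh p.2.2.1)
  have ha' : τ'.a = τ.u ∨ τ'.a = τ.a := by
    rcases ha with h | h | h
    · exact Or.inl h
    · exact Or.inr h
    · exact absurd (h ▸ p'.2.1) (fun hh => Finset.disjoint_left.1 hHS hh p.2.2.1)
  have hlt := p.2.2.2.2; have hlt' := p'.2.2.2.2
  rcases hu' with h1 | h1 <;> rcases ha' with h2 | h2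
  · exact absurd (h1.trans h2.symm) (ne_of_lt hlt')
  · exact Triple.ext' h1 h2 hbb
  · rw [h1, h2] at hlt'; exact absurd hlt (lt_asymm hlt')
  · exact absurd (h1.trans h2.symm) (ne_of_lt hlt')

/-- **The cubic expectation as an indicator sum over the triples**: `⟨ξ_ν, X_iX_jX_kξ_ν⟩` equals
`⟨ξ_ν, X_uX_aX_bξ_ν⟩` for the unique triple `τ = (u,a,b)` of which `(i,j,k)` is an arrangement, and
`0` if there is none. [cite: BastiCenatiempoSchlein2021, §4, §5.2] -/
theorem cubicExp_eq_sum_ite (hHS : Disjoint PH PS) (κ : Triple e PH PS → ℂ) (i j k : ι) :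
    fockInner (cubicVector e PH PS κ) (X i * (X j * (X k * cubicVector e PH PS κ))) =
      ∑ τ : Triple e PH PS,
        (if (i = τ.u ∧ j = τ.a ∧ k = τ.b) ∨ (i = τ.a ∧ j = τ.u ∧ k = τ.b) ∨ (i = τ.u ∧ j = τ.b ∧ k = τ.a) ∨
            (i = τ.a ∧ j = τ.b ∧ k = τ.u) ∨ (i = τ.b ∧ j = τ.u ∧ k = τ.a) ∨ (i = τ.b ∧ j = τ.a ∧ k = τ.u) then
          fockInner (cubicVector e PH PS κ) (X τ.u * (X τ.a * (X τ.b * cubicVector e PH PS κ))) else 0) := by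
  classical
  set ξ := cubicVector e PH PS κ with hξ
  set V : ι → ι → ι → ℂ := fun i j k => fockInner ξ (X i * (X j * (X k * ξ))) with hV
  -- symmetry of `V`
  have s12 : ∀ i j k, V i j k = V j i k := fun i j k => cubicExp_swap₁₂ κ i j k
  have s23 : ∀ i j k, V i j k = V i k j := fun i j k => cubicExp_swap₂₃ κ i j k
  -- the value on an arrangement
  have harr : ∀ (τ : Triple e PH PS) (i j k : ι),
      ((i = τ.u ∧ j = τ.a ∧ k = τ.b) ∨ (i = τ.a ∧ j = τ.u ∧ k = τ.b) ∨ (i = τ.u ∧ j = τ.b ∧ k = τ.a) ∨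
        (i = τ.a ∧ j = τ.b ∧ k = τ.u) ∨ (i = τ.b ∧ j = τ.u ∧ k = τ.a) ∨ (i = τ.b ∧ j = τ.a ∧ k = τ.u)) →
      V i j k = V τ.u τ.a τ.b := by
    rintro τ i j k (⟨rfl, rfl, rfl⟩ | ⟨rfl, rfl, rfl⟩ | ⟨rfl, rfl, rfl⟩ | ⟨rfl, rfl, rfl⟩ | ⟨rfl, rfl, rfl⟩ |
      ⟨rfl, rfl, rfl⟩)
    · rfl
    · exact s12 _ _ _
    · exact s23 _ _ _
    · rw [s23, s12]
    · rw [s12, s23]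
    · rw [s23, s12, s23]
  -- an arrangement determines the triple
  have huniq : ∀ (τ τ' : Triple e PH PS) (i j k : ι),
      ((i = τ.u ∧ j = τ.a ∧ k = τ.b) ∨ (i = τ.a ∧ j = τ.u ∧ k = τ.b) ∨ (i = τ.u ∧ j = τ.b ∧ k = τ.a) ∨
        (i = τ.a ∧ j = τ.b ∧ k = τ.u) ∨ (i = τ.b ∧ j = τ.u ∧ k = τ.a) ∨ (i = τ.b ∧ j = τ.a ∧ k = τ.u)) →
      ((i = τ'.u ∧ j = τ'.a ∧ k = τ'.b) ∨ (i = τ'.a ∧ j = τ'.u ∧ k = τ'.b) ∨ (i = τ'.u ∧ j = τ'.b ∧ k = τ'.a) ∨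
        (i = τ'.a ∧ j = τ'.b ∧ k = τ'.u) ∨ (i = τ'.b ∧ j = τ'.u ∧ k = τ'.a) ∨ (i = τ'.b ∧ j = τ'.a ∧ k = τ'.u)) →
      τ' = τ := by
    intro τ τ' i j k h h'
    -- the three slots of `τ'` are among `{i, j, k} = {u, a, b}`
    have hmem : ∀ z : ι, (z = i ∨ z = j ∨ z = k) → (z = τ.u ∨ z = τ.a ∨ z = τ.b) := by
      intro z hz
      rcases h with ⟨h1, h2, h3⟩ | ⟨h1, h2, h3⟩ | ⟨h1, h2, h3⟩ | ⟨h1, h2, h3⟩ | ⟨h1, h2, h3⟩ | ⟨h1, h2, h3⟩ <;>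
        rcases hz with rfl | rfl | rfl <;> simp [h1, h2, h3]
    refine Triple.eq_of_modes hHS (hmem τ'.u ?_) (hmem τ'.a ?_) (hmem τ'.b ?_)
    · rcases h' with ⟨h1, -, -⟩ | ⟨-, h2, -⟩ | ⟨h1, -, -⟩ | ⟨-, -, h3⟩ | ⟨-, h2, -⟩ | ⟨-, -, h3⟩
      exacts [Or.inl h1.symm, Or.inr (Or.inl h2.symm), Or.inl h1.symm, Or.inr (Or.inr h3.symm),
        Or.inr (Or.inl h2.symm), Or.inr (Or.inr h3.symm)]
    · rcases h' with ⟨-, h2, -⟩ | ⟨h1, -, -⟩ | ⟨-, -, h3⟩ | ⟨h1, -, -⟩ | ⟨-, -, h3⟩ | ⟨-, h2, -⟩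
      exacts [Or.inr (Or.inl h2.symm), Or.inl h1.symm, Or.inr (Or.inr h3.symm), Or.inl h1.symm,
        Or.inr (Or.inr h3.symm), Or.inr (Or.inl h2.symm)]
    · rcases h' with ⟨-, -, h3⟩ | ⟨-, -, h3⟩ | ⟨-, h2, -⟩ | ⟨-, h2, -⟩ | ⟨h1, -, -⟩ | ⟨h1, -, -⟩
      exacts [Or.inr (Or.inr h3.symm), Or.inr (Or.inr h3.symm), Or.inr (Or.inl h2.symm), Or.inr (Or.inl h2.symm),
        Or.inl h1.symm, Or.inl h1.symm]
  by_cases hex : ∃ τ : Triple e PH PS,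
      (i = τ.u ∧ j = τ.a ∧ k = τ.b) ∨ (i = τ.a ∧ j = τ.u ∧ k = τ.b) ∨ (i = τ.u ∧ j = τ.b ∧ k = τ.a) ∨
        (i = τ.a ∧ j = τ.b ∧ k = τ.u) ∨ (i = τ.b ∧ j = τ.u ∧ k = τ.a) ∨ (i = τ.b ∧ j = τ.a ∧ k = τ.u)
  · obtain ⟨τ, hτ⟩ := hex
    rw [Finset.sum_eq_single τ]
    · rw [if_pos hτ]; exact harr τ i j k hτ
    · intro τ' _ hne
      rw [if_neg]
      intro h'
      exact hne (huniq τ τ' i j k hτ h')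
    · intro h; exact absurd (Finset.mem_univ τ) h
  · -- no arrangement: the expectation vanishes
    rw [Finset.sum_eq_zero (fun τ _ => if_neg (fun h => hex ⟨τ, h⟩))]
    show V i j k = 0
    -- modes outside `P_H ∪ P_S`
    by_cases hi : i ∉ PH ∧ i ∉ PS
    · exact cubicExp_eq_zero_of_not_mem κ hi.1 hi.2 j k
    by_cases hj : j ∉ PH ∧ j ∉ PS
    · rw [s12]; exact cubicExp_eq_zero_of_not_mem κ hj.1 hj.2 i k
    by_cases hk : k ∉ PH ∧ k ∉ PS
    · rw [s23, s12]; exact cubicExp_eq_zero_of_not_mem κ hk.1 hk.2 i j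
    -- the `P_H/P_S` count
    set w : ι → ℤ := fun i => if i ∈ PH then (1 : ℤ) else if i ∈ PS then -2 else 0 with hw
    have hwτ : ∀ τ : Triple e PH PS, w τ.u + w τ.a + w τ.b = 0 := hsWeight_triple hHS
    have hdisj : ∀ {z : ι}, z ∈ PH → z ∉ PS := fun hz hz' => Finset.disjoint_left.1 hHS hz hz'
    have hwval : ∀ {z : ι}, ¬ (z ∉ PH ∧ z ∉ PS) → (z ∈ PH ∧ w z = 1) ∨ (z ∈ PS ∧ w z = -2) := by
      intro z hz
      by_cases hzH : z ∈ PH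
      · left; exact ⟨hzH, by simp [hw, hzH]⟩
      · right
        have hzS : z ∈ PS := by by_contra hzS; exact hz ⟨hzH, hzS⟩
        exact ⟨hzS, by simp [hw, hzH, hzS]⟩
    by_cases hW : w i + w j + w k ≠ 0
    · exact cubicExp_eq_zero_of_weight_ne κ w hwτ hW
    push Not at hW
    by_cases hmom : e i + e j + e k ≠ 0
    · exact cubicExp_eq_zero_of_momentum_ne κ hmom
    push Not at hmom
    -- exactly two hard modes and one soft mode; locate the soft one
    -- helper: two distinct hard modes `x, y` and a soft `s` with momentum zero give a triple
    have mk : ∀ {x y s : ι}, x ∈ PH → y ∈ PH → s ∈ PS → e x + e y + e s = 0 → x ≠ y →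
        ∃ τ : Triple e PH PS, (x = τ.u ∧ y = τ.a ∨ x = τ.a ∧ y = τ.u) ∧ s = τ.b := by
      intro x y s hx hy hs hsum hxy
      rcases lt_or_gt_of_ne hxy with hlt | hgt
      · exact ⟨⟨(x, y, s), hx, hy, hs, hsum, hlt⟩, Or.inl ⟨rfl, rfl⟩, rfl⟩
      · refine ⟨⟨(y, x, s), hy, hx, hs, by rw [add_comm (e y)]; exact hsum, hgt⟩, Or.inr ⟨rfl, rfl⟩, rfl⟩
    rcases hwval hi with ⟨hiH, wi⟩ | ⟨hiS, wi⟩ <;> rcases hwval hj with ⟨hjH, wj⟩ | ⟨hjS, wj⟩ <;>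
      rcases hwval hk with ⟨hkH, wk⟩ | ⟨hkS, wk⟩ <;> rw [wi, wj, wk] at hW <;> norm_num at hW
    · -- (H, H, S): `k` soft
      by_cases hij : i = j
      · subst hij; exact cubicExp_eq_zero_of_eq hHS κ i k
      obtain ⟨τ, hxy, hs⟩ := mk hiH hjH hkS hmom hij
      exfalso; apply hex; refine ⟨τ, ?_⟩
      rcases hxy with ⟨h1, h2⟩ | ⟨h1, h2⟩
      · exact Or.inl ⟨h1, h2, hs⟩
      · exact Or.inr (Or.inl ⟨h1, h2, hs⟩)
    · -- (H, S, H): `j` soft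
      by_cases hik : i = k
      · subst hik; rw [s23]; exact cubicExp_eq_zero_of_eq hHS κ i j
      have hsum : e i + e k + e j = 0 := by rw [← hmom]; abel
      obtain ⟨τ, hxy, hs⟩ := mk hiH hkH hjS hsum hik
      exfalso; apply hex; refine ⟨τ, ?_⟩
      rcases hxy with ⟨h1, h2⟩ | ⟨h1, h2⟩
      · exact Or.inr (Or.inr (Or.inl ⟨h1, hs, h2⟩))
      · exact Or.inr (Or.inr (Or.inr (Or.inl ⟨h1, hs, h2⟩)))
    · -- (S, H, H): `i` soft
      by_cases hjk : j = k
      · subst hjk; rw [s12, s23]; exact cubicExp_eq_zero_of_eq hHS κ j i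
      have hsum : e j + e k + e i = 0 := by rw [← hmom]; abel
      obtain ⟨τ, hxy, hs⟩ := mk hjH hkH hiS hsum hjk
      exfalso; apply hex; refine ⟨τ, ?_⟩
      rcases hxy with ⟨h1, h2⟩ | ⟨h1, h2⟩
      · exact Or.inr (Or.inr (Or.inr (Or.inr (Or.inl ⟨hs, h1, h2⟩))))
      · exact Or.inr (Or.inr (Or.inr (Or.inr (Or.inr ⟨hs, h1, h2⟩))))

/-- **Every cubic expectation lives on the triples**:
`∑_{i,j,k} f(i,j,k)⟨ξ_ν, X_iX_jX_kξ_ν⟩ = ∑_τ f̃(τ) ⟨ξ_ν, X_uX_aX_bξ_ν⟩`, `f̃` = the sum of `f` over the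
six arrangements of `(u, a, b)`. [cite: BastiCenatiempoSchlein2021, §4 (`⟨ξ_ν,𝒢^{(3)}_Nξ_ν⟩ = ⟨ξ_ν,𝒞_Nξ_ν⟩ + ∑⟨ξ_ν,F_jξ_ν⟩ + h.c.`), §5.2] -/
theorem sum_mul_cubicExp_eq_sum_triples (hHS : Disjoint PH PS) (κ : Triple e PH PS → ℂ) (f : ι → ι → ι → ℂ) :
    ∑ i, ∑ j, ∑ k, f i j k * fockInner (cubicVector e PH PS κ) (X i * (X j * (X k * cubicVector e PH PS κ))) =
      ∑ τ : Triple e PH PS, (f τ.u τ.a τ.b + f τ.a τ.u τ.b + f τ.u τ.b τ.a + f τ.a τ.b τ.u + f τ.b τ.u τ.a +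
          f τ.b τ.a τ.u) * fockInner (cubicVector e PH PS κ) (X τ.u * (X τ.a * (X τ.b * cubicVector e PH PS κ))) := by
  classical
  have hexp : ∀ i j k : ι, f i j k * fockInner (cubicVector e PH PS κ) (X i * (X j * (X k * cubicVector e PH PS κ))) =
      ∑ τ : Triple e PH PS,
        (if (i = τ.u ∧ j = τ.a ∧ k = τ.b) ∨ (i = τ.a ∧ j = τ.u ∧ k = τ.b) ∨ (i = τ.u ∧ j = τ.b ∧ k = τ.a) ∨
            (i = τ.a ∧ j = τ.b ∧ k = τ.u) ∨ (i = τ.b ∧ j = τ.u ∧ k = τ.a) ∨ (i = τ.b ∧ j = τ.a ∧ k = τ.u) then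
          f i j k * fockInner (cubicVector e PH PS κ) (X τ.u * (X τ.a * (X τ.b * cubicVector e PH PS κ))) else 0) := by
    intro i j k
    rw [cubicExp_eq_sum_ite hHS κ i j k, Finset.mul_sum]
    refine Finset.sum_congr rfl fun τ _ => ?_
    rw [mul_ite, mul_zero]
  simp only [hexp]
  -- bring the sum over triples outside
  rw [sum_comm₃₁]
  refine Finset.sum_congr rfl fun τ _ => ?_
  have p := τ.prop
  have hua : τ.u ≠ τ.a := ne_of_lt p.2.2.2.2
  have hub : τ.u ≠ τ.b := fun h => Finset.disjoint_left.1 hHS p.1 (h ▸ p.2.2.1)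
  have hab : τ.a ≠ τ.b := fun h => Finset.disjoint_left.1 hHS p.2.1 (h ▸ p.2.2.1)
  -- split the indicator into the six (disjoint) arrangements
  have hsplit : ∀ i j k : ι,
      (if (i = τ.u ∧ j = τ.a ∧ k = τ.b) ∨ (i = τ.a ∧ j = τ.u ∧ k = τ.b) ∨ (i = τ.u ∧ j = τ.b ∧ k = τ.a) ∨
          (i = τ.a ∧ j = τ.b ∧ k = τ.u) ∨ (i = τ.b ∧ j = τ.u ∧ k = τ.a) ∨ (i = τ.b ∧ j = τ.a ∧ k = τ.u) then
        f i j k * fockInner (cubicVector e PH PS κ) (X τ.u * (X τ.a * (X τ.b * cubicVector e PH PS κ))) else 0) =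
      ((if i = τ.u ∧ j = τ.a ∧ k = τ.b then f i j k else 0) + (if i = τ.a ∧ j = τ.u ∧ k = τ.b then f i j k else 0) +
        (if i = τ.u ∧ j = τ.b ∧ k = τ.a then f i j k else 0) + (if i = τ.a ∧ j = τ.b ∧ k = τ.u then f i j k else 0) +
        (if i = τ.b ∧ j = τ.u ∧ k = τ.a then f i j k else 0) + (if i = τ.b ∧ j = τ.a ∧ k = τ.u then f i j k else 0)) *
        fockInner (cubicVector e PH PS κ) (X τ.u * (X τ.a * (X τ.b * cubicVector e PH PS κ))) := by
    intro i j k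
    by_cases h1 : i = τ.u ∧ j = τ.a ∧ k = τ.b
    · rw [if_pos (Or.inl h1)]
      rw [if_neg (show ¬ (i = τ.a ∧ j = τ.u ∧ k = τ.b) from fun h => hua (h1.1.symm.trans h.1))]
      rw [if_neg (show ¬ (i = τ.u ∧ j = τ.b ∧ k = τ.a) from fun h => hab (h1.2.1.symm.trans h.2.1))]
      rw [if_neg (show ¬ (i = τ.a ∧ j = τ.b ∧ k = τ.u) from fun h => hua (h1.1.symm.trans h.1))]
      rw [if_neg (show ¬ (i = τ.b ∧ j = τ.u ∧ k = τ.a) from fun h => hub (h1.1.symm.trans h.1))]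
      rw [if_neg (show ¬ (i = τ.b ∧ j = τ.a ∧ k = τ.u) from fun h => hub (h1.1.symm.trans h.1))]
      rw [if_pos h1]
      ring
    by_cases h2 : i = τ.a ∧ j = τ.u ∧ k = τ.b
    · rw [if_pos (Or.inr (Or.inl h2))]
      rw [if_neg (show ¬ (i = τ.u ∧ j = τ.a ∧ k = τ.b) from fun h => hua.symm (h2.1.symm.trans h.1))]
      rw [if_neg (show ¬ (i = τ.u ∧ j = τ.b ∧ k = τ.a) from fun h => hua.symm (h2.1.symm.trans h.1))]
      rw [if_neg (show ¬ (i = τ.a ∧ j = τ.b ∧ k = τ.u) from fun h => hub (h2.2.1.symm.trans h.2.1))]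
      rw [if_neg (show ¬ (i = τ.b ∧ j = τ.u ∧ k = τ.a) from fun h => hab (h2.1.symm.trans h.1))]
      rw [if_neg (show ¬ (i = τ.b ∧ j = τ.a ∧ k = τ.u) from fun h => hab (h2.1.symm.trans h.1))]
      rw [if_pos h2]
      ring
    by_cases h3 : i = τ.u ∧ j = τ.b ∧ k = τ.a
    · rw [if_pos (Or.inr (Or.inr (Or.inl h3)))]
      rw [if_neg (show ¬ (i = τ.u ∧ j = τ.a ∧ k = τ.b) from fun h => hab.symm (h3.2.1.symm.trans h.2.1))]
      rw [if_neg (show ¬ (i = τ.a ∧ j = τ.u ∧ k = τ.b) from fun h => hua (h3.1.symm.trans h.1))]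
      rw [if_neg (show ¬ (i = τ.a ∧ j = τ.b ∧ k = τ.u) from fun h => hua (h3.1.symm.trans h.1))]
      rw [if_neg (show ¬ (i = τ.b ∧ j = τ.u ∧ k = τ.a) from fun h => hub (h3.1.symm.trans h.1))]
      rw [if_neg (show ¬ (i = τ.b ∧ j = τ.a ∧ k = τ.u) from fun h => hub (h3.1.symm.trans h.1))]
      rw [if_pos h3]
      ring
    by_cases h4 : i = τ.a ∧ j = τ.b ∧ k = τ.u
    · rw [if_pos (Or.inr (Or.inr (Or.inr (Or.inl h4))))]
      rw [if_neg (show ¬ (i = τ.u ∧ j = τ.a ∧ k = τ.b) from fun h => hua.symm (h4.1.symm.trans h.1))]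
      rw [if_neg (show ¬ (i = τ.a ∧ j = τ.u ∧ k = τ.b) from fun h => hub.symm (h4.2.1.symm.trans h.2.1))]
      rw [if_neg (show ¬ (i = τ.u ∧ j = τ.b ∧ k = τ.a) from fun h => hua.symm (h4.1.symm.trans h.1))]
      rw [if_neg (show ¬ (i = τ.b ∧ j = τ.u ∧ k = τ.a) from fun h => hab (h4.1.symm.trans h.1))]
      rw [if_neg (show ¬ (i = τ.b ∧ j = τ.a ∧ k = τ.u) from fun h => hab (h4.1.symm.trans h.1))]
      rw [if_pos h4]
      ring
    by_cases h5 : i = τ.b ∧ j = τ.u ∧ k = τ.a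
    · rw [if_pos (Or.inr (Or.inr (Or.inr (Or.inr (Or.inl h5)))))]
      rw [if_neg (show ¬ (i = τ.u ∧ j = τ.a ∧ k = τ.b) from fun h => hub.symm (h5.1.symm.trans h.1))]
      rw [if_neg (show ¬ (i = τ.a ∧ j = τ.u ∧ k = τ.b) from fun h => hab.symm (h5.1.symm.trans h.1))]
      rw [if_neg (show ¬ (i = τ.u ∧ j = τ.b ∧ k = τ.a) from fun h => hub.symm (h5.1.symm.trans h.1))]
      rw [if_neg (show ¬ (i = τ.a ∧ j = τ.b ∧ k = τ.u) from fun h => hab.symm (h5.1.symm.trans h.1))]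
      rw [if_neg (show ¬ (i = τ.b ∧ j = τ.a ∧ k = τ.u) from fun h => hua (h5.2.1.symm.trans h.2.1))]
      rw [if_pos h5]
      ring
    by_cases h6 : i = τ.b ∧ j = τ.a ∧ k = τ.u
    · rw [if_pos (Or.inr (Or.inr (Or.inr (Or.inr (Or.inr (h6))))))]
      rw [if_neg (show ¬ (i = τ.u ∧ j = τ.a ∧ k = τ.b) from fun h => hub.symm (h6.1.symm.trans h.1))]
      rw [if_neg (show ¬ (i = τ.a ∧ j = τ.u ∧ k = τ.b) from fun h => hab.symm (h6.1.symm.trans h.1))]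
      rw [if_neg (show ¬ (i = τ.u ∧ j = τ.b ∧ k = τ.a) from fun h => hub.symm (h6.1.symm.trans h.1))]
      rw [if_neg (show ¬ (i = τ.a ∧ j = τ.b ∧ k = τ.u) from fun h => hab.symm (h6.1.symm.trans h.1))]
      rw [if_neg (show ¬ (i = τ.b ∧ j = τ.u ∧ k = τ.a) from fun h => hua.symm (h6.2.1.symm.trans h.2.1))]
      rw [if_pos h6]
      ring
    rw [if_neg (by rintro (h | h | h | h | h | h) <;> [exact h1 h; exact h2 h; exact h3 h; exact h4 h; exact h5 h; exact h6 h]),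
      if_neg h1, if_neg h2, if_neg h3, if_neg h4, if_neg h5, if_neg h6]
    ring
  simp_rw [hsplit, ← Finset.sum_mul]
  congr 1
  -- each of the six indicator sums collapses
  have hone : ∀ x y z : ι, ∑ i, ∑ j, ∑ k, (if i = x ∧ j = y ∧ k = z then f i j k else 0) = f x y z := by
    intro x y z
    rw [Finset.sum_eq_single_of_mem x (Finset.mem_univ x) (fun i _ hi => Finset.sum_eq_zero fun j _ =>
      Finset.sum_eq_zero fun k _ => if_neg (fun h => hi h.1))]
    rw [Finset.sum_eq_single_of_mem y (Finset.mem_univ y) (fun j _ hj => Finset.sum_eq_zero fun k _ =>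
      if_neg (fun h => hj h.2.1))]
    rw [Finset.sum_eq_single_of_mem z (Finset.mem_univ z) (fun k _ hk => if_neg (fun h => hk h.2.2))]
    rw [if_pos ⟨rfl, rfl, rfl⟩]
  simp only [Finset.sum_add_distrib, hone]

end Arrangements

/-! ### Freeing and the crude bound -/

section Freeing

variable [Fintype ι]

/-- **The cubic expectation, freed**: `∑ f(i,j,k)⟨ξ_ν, X_iX_jX_kξ_ν⟩ = (∑_τ f̃_τ conj κ_τ)‖ξ_ν‖² - ∑_τ f̃_τ conj(κ_τ) D_τ`
with the cutoff defect `D_τ = ∑_{θ(S), τ∈S ∨ ¬θ(S∪τ)} |c_S|²` — main term `I` plus cutoff error `J`.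
[cite: BastiCenatiempoSchlein2021, §5.2 (5.8)–(5.10)] -/
theorem sum_mul_cubicExp_eq_freed (hHS : Disjoint PH PS) (κ : Triple e PH PS → ℂ) (f : ι → ι → ι → ℂ) :
    ∑ i, ∑ j, ∑ k, f i j k * fockInner (cubicVector e PH PS κ) (X i * (X j * (X k * cubicVector e PH PS κ))) =
      (∑ τ : Triple e PH PS, (f τ.u τ.a τ.b + f τ.a τ.u τ.b + f τ.u τ.b τ.a + f τ.a τ.b τ.u + f τ.b τ.u τ.a +
          f τ.b τ.a τ.u) * conj (κ τ)) *
          ((∑ S : Finset (Triple e PH PS), ‖setCoeff κ (TripleAdm e) S‖ ^ 2 : ℝ) : ℂ) -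
        ∑ τ : Triple e PH PS, (f τ.u τ.a τ.b + f τ.a τ.u τ.b + f τ.u τ.b τ.a + f τ.a τ.b τ.u + f τ.b τ.u τ.a +
          f τ.b τ.a τ.u) * conj (κ τ) *
          ((∑ S : Finset (Triple e PH PS), (if TripleAdm e S ∧ (τ ∈ S ∨ ¬ TripleAdm e (insert τ S)) then
            ‖setCoeff κ (TripleAdm e) S‖ ^ 2 else 0) : ℝ) : ℂ) := by
  rw [sum_mul_cubicExp_eq_sum_triples hHS κ f]
  exact sum_mul_fockInner_cubicVector_create hHS κ _

/-- The cutoff defect lies between `0` and `‖ξ_ν‖²`. [folklore] -/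
theorem defect_nonneg_le (κ : Triple e PH PS → ℂ) (τ : Triple e PH PS) :
    0 ≤ (∑ S : Finset (Triple e PH PS), (if TripleAdm e S ∧ (τ ∈ S ∨ ¬ TripleAdm e (insert τ S)) then
        ‖setCoeff κ (TripleAdm e) S‖ ^ 2 else 0)) ∧
      (∑ S : Finset (Triple e PH PS), (if TripleAdm e S ∧ (τ ∈ S ∨ ¬ TripleAdm e (insert τ S)) then
        ‖setCoeff κ (TripleAdm e) S‖ ^ 2 else 0)) ≤ ∑ S : Finset (Triple e PH PS), ‖setCoeff κ (TripleAdm e) S‖ ^ 2 :=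
  ⟨Finset.sum_nonneg fun S _ => by split_ifs <;> positivity,
    Finset.sum_le_sum fun S _ => by split_ifs <;> nlinarith [sq_nonneg ‖setCoeff κ (TripleAdm e) S‖]⟩

/-- **Crude bound**: `|∑ f(i,j,k)⟨ξ_ν, X_iX_jX_kξ_ν⟩| ≤ 2 (∑_τ |f̃_τ||κ_τ|) ‖ξ_ν‖²` (no cancellation used;
sufficient for the terms `F₁, F₂, F₃` of [ibid., §4]). [cite: BastiCenatiempoSchlein2021, §4 (bounds for `F₁`–`F₃`)] -/
theorem norm_sum_mul_cubicExp_le (hHS : Disjoint PH PS) (κ : Triple e PH PS → ℂ) (f : ι → ι → ι → ℂ) :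
    ‖∑ i, ∑ j, ∑ k, f i j k * fockInner (cubicVector e PH PS κ) (X i * (X j * (X k * cubicVector e PH PS κ)))‖ ≤
      2 * (∑ τ : Triple e PH PS, ‖f τ.u τ.a τ.b + f τ.a τ.u τ.b + f τ.u τ.b τ.a + f τ.a τ.b τ.u + f τ.b τ.u τ.a +
          f τ.b τ.a τ.u‖ * ‖κ τ‖) * ∑ S : Finset (Triple e PH PS), ‖setCoeff κ (TripleAdm e) S‖ ^ 2 := by
  rw [sum_mul_cubicExp_eq_freed hHS κ f]
  set M : ℝ := ∑ S : Finset (Triple e PH PS), ‖setCoeff κ (TripleAdm e) S‖ ^ 2 with hM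
  have hM0 : 0 ≤ M := Finset.sum_nonneg fun S _ => sq_nonneg _
  set ft : Triple e PH PS → ℂ := fun τ => f τ.u τ.a τ.b + f τ.a τ.u τ.b + f τ.u τ.b τ.a + f τ.a τ.b τ.u +
    f τ.b τ.u τ.a + f τ.b τ.a τ.u with hft
  refine (norm_sub_le _ _).trans ?_
  have h1 : ‖(∑ τ : Triple e PH PS, ft τ * conj (κ τ)) * ((M : ℝ) : ℂ)‖ ≤ (∑ τ, ‖ft τ‖ * ‖κ τ‖) * M := by
    rw [norm_mul, Complex.norm_real, Real.norm_of_nonneg hM0]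
    refine mul_le_mul_of_nonneg_right ((norm_sum_le _ _).trans (le_of_eq ?_)) hM0
    refine Finset.sum_congr rfl fun τ _ => ?_
    rw [norm_mul, Complex.norm_conj]
  have h2 : ‖∑ τ : Triple e PH PS, ft τ * conj (κ τ) *
      ((∑ S : Finset (Triple e PH PS), (if TripleAdm e S ∧ (τ ∈ S ∨ ¬ TripleAdm e (insert τ S)) then
        ‖setCoeff κ (TripleAdm e) S‖ ^ 2 else 0) : ℝ) : ℂ)‖ ≤ (∑ τ, ‖ft τ‖ * ‖κ τ‖) * M := by
    rw [Finset.sum_mul]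
    refine (norm_sum_le _ _).trans (Finset.sum_le_sum fun τ _ => ?_)
    obtain ⟨hD0, hDM⟩ := defect_nonneg_le κ τ
    rw [norm_mul, norm_mul, Complex.norm_conj, Complex.norm_real, Real.norm_of_nonneg hD0]
    exact mul_le_mul_of_nonneg_left hDM (by positivity)
  linarith

end Freeing

/-! ### Coincidences: what makes a triple incompatible with an admissible set -/

section Coincidence

/-- **A triple incompatible with an admissible `S` is in coincidence with it**: if `θ(S)` and
`τ ∈ S ∨ ¬θ(S ∪ τ)`, then either (two indices) some `τ' ∈ S` has the same soft slot, shares a hard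
mode, or satisfies one of the relations `2e(p) + e(b') = 0` (`p` hard in `τ`), `2e(p') + e(b) = 0`
(`p'` hard in `τ'`), or (three indices) some `τⱼ ≠ τₖ ∈ S` satisfy `e(pⱼ) + e(pₖ) + e(b) = 0` or
`e(p) + e(pₖ) + e(bⱼ) = 0` (`p ∈ τ`, `pⱼ ∈ τⱼ`, `pₖ ∈ τₖ` hard) — the list behind
`|θ_m - 1| ≤ ∑_j [δ_{v_j,v_m} + ∑δ_{p_m,p_j}] + ∑_{j≠k}[∑δ_{v_m,p_j+p_k} + ∑δ_{p_m,-p_j+v_k}]`.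
[cite: BastiCenatiempoSchlein2021, §5.2 (5.15)] -/
theorem TripleAdm.coincidence_of_incompatible {S : Finset (Triple e PH PS)} (hS : TripleAdm e S)
    (he : Function.Injective e) {τ : Triple e PH PS} (h : τ ∈ S ∨ ¬ TripleAdm e (insert τ S)) :
    (∃ τ' ∈ S, τ.b = τ'.b ∨ (∃ p, (p = τ.u ∨ p = τ.a) ∧ (p = τ'.u ∨ p = τ'.a)) ∨
      (∃ p, (p = τ.u ∨ p = τ.a) ∧ e p + e p + e τ'.b = 0) ∨ (∃ p', (p' = τ'.u ∨ p' = τ'.a) ∧ e p' + e p' + e τ.b = 0)) ∨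
    (∃ τj ∈ S, ∃ τk ∈ S, τj ≠ τk ∧
      ((∃ pj pk, (pj = τj.u ∨ pj = τj.a) ∧ (pk = τk.u ∨ pk = τk.a) ∧ e pj + e pk + e τ.b = 0) ∨
        (∃ p pk, (p = τ.u ∨ p = τ.a) ∧ (pk = τk.u ∨ pk = τk.a) ∧ e p + e pk + e τj.b = 0))) := by
  classical
  have memIff : ∀ {p : ι} {ρ : Triple e PH PS}, p ∈ ({ρ.u, ρ.a} : Finset ι) ↔ (p = ρ.u ∨ p = ρ.a) := by
    intro p ρ; simp
  -- the complementary hard slot: `e p + e(other) + e b = 0`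
  have other : ∀ (ρ : Triple e PH PS) {p : ι}, (p = ρ.u ∨ p = ρ.a) →
      ∃ p', (p' = ρ.u ∨ p' = ρ.a) ∧ e p + e p' + e ρ.b = 0 := by
    intro ρ p hp
    have hs := ρ.prop.2.2.2.1
    rcases hp with rfl | rfl
    · exact ⟨ρ.a, Or.inr rfl, hs⟩
    · exact ⟨ρ.u, Or.inl rfl, by rw [add_comm (e ρ.a)]; exact hs⟩
  -- two hard slots of one triple `ρ` with `e p + e p' + e c = 0`: either `e c = e b_ρ` or `p = p'`
  have sameTriple : ∀ (ρ : Triple e PH PS) {p p' c : ι}, (p = ρ.u ∨ p = ρ.a) → (p' = ρ.u ∨ p' = ρ.a) →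
      e p + e p' + e c = 0 → e c = e ρ.b ∨ (p = p' ∧ e p + e p + e c = 0) := by
    intro ρ p p' c hp hp' hsum
    by_cases hpp : p = p'
    · right; exact ⟨hpp, by rw [← hpp] at hsum; exact hsum⟩
    · left
      have hs := ρ.prop.2.2.2.1
      have hpair : e p + e p' = e ρ.u + e ρ.a := by
        rcases hp with rfl | rfl <;> rcases hp' with h' | h'
        · exact absurd h'.symm hpp
        · rw [h']
        · rw [h', add_comm]
        · exact absurd h'.symm hpp
      have h1 : e c = -(e p + e p') := by linear_combination hsum
      have h2 : e ρ.b = -(e ρ.u + e ρ.a) := by linear_combination hs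
      rw [h1, h2, hpair]
  rcases h with hτS | hnot
  · exact Or.inl ⟨τ, hτS, Or.inl rfl⟩
  -- unfold the failure of `θ(S ∪ τ)`
  unfold TripleAdm at hnot
  push Not at hnot
  obtain ⟨τi, hi, τj, hj, τk, hk, hjk, pi, hpi, pk, hpk, hsum⟩ := hnot
  rw [memIff] at hpi hpk
  rcases Finset.mem_insert.1 hi with hiτ | hiS <;> rcases Finset.mem_insert.1 hj with hjτ | hjS <;>
    rcases Finset.mem_insert.1 hk with hkτ | hkS
  · exact absurd (hjτ.trans hkτ.symm) hjk
  · -- i = j = τ, k ∈ S: `pk` is the other hard slot of `τ`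
    rw [hiτ] at hpi; rw [hjτ] at hsum
    obtain ⟨p', hp', hsum'⟩ := other τ hpi
    have hpk' : pk = p' := he (by linear_combination hsum - hsum')
    exact Or.inl ⟨τk, hkS, Or.inr (Or.inl ⟨pk, by rw [hpk']; exact hp', hpk⟩)⟩
  · -- i = τ, j ∈ S, k = τ
    rw [hiτ] at hpi; rw [hkτ] at hpk
    rcases sameTriple τ hpi hpk hsum with hb | ⟨-, h2⟩
    · exact Or.inl ⟨τj, hjS, Or.inl (he hb).symm⟩
    · exact Or.inl ⟨τj, hjS, Or.inr (Or.inr (Or.inl ⟨pi, hpi, h2⟩))⟩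
  · -- i = τ, j ∈ S, k ∈ S
    rw [hiτ] at hpi
    exact Or.inr ⟨τj, hjS, τk, hkS, hjk, Or.inr ⟨pi, pk, hpi, hpk, hsum⟩⟩
  · exact absurd (hjτ.trans hkτ.symm) hjk
  · -- i ∈ S, j = τ, k ∈ S
    rw [hjτ] at hsum
    by_cases hik : τi = τk
    · rw [hik] at hpi hiS
      rcases sameTriple τk hpi hpk hsum with hb | ⟨-, h2⟩
      · exact Or.inl ⟨τk, hkS, Or.inl (he hb)⟩
      · exact Or.inl ⟨τk, hkS, Or.inr (Or.inr (Or.inr ⟨pi, hpi, h2⟩))⟩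
    · exact Or.inr ⟨τi, hiS, τk, hkS, hik, Or.inl ⟨pi, pk, hpi, hpk, hsum⟩⟩
  · -- i ∈ S, j ∈ S, k = τ
    rw [hkτ] at hpk
    by_cases hij : τj = τi
    · obtain ⟨p', hp', hsum'⟩ := other τi hpi
      have hpk' : pk = p' := he (by rw [hij] at hsum; linear_combination hsum - hsum')
      exact Or.inl ⟨τi, hiS, Or.inr (Or.inl ⟨pk, hpk, by rw [hpk']; exact hp'⟩)⟩
    · refine Or.inr ⟨τj, hjS, τi, hiS, hij, Or.inr ⟨pk, pi, hpk, hpi, ?_⟩⟩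
      rw [add_comm (e pk)]; exact hsum
  · -- all in `S`: contradicts `θ(S)`
    exact absurd hsum (hS τi hiS τj hjS τk hkS hjk pi (memIff.2 hpi) pk (memIff.2 hpk))

/-- **The coincidence bound for the cutoff error.** For weights `g ≥ 0` on the triples let `F₁`
bound the two-index coincidence sums `∑_τ [C₁(τ,τ')] g_τ` uniformly in `τ'`, and `F₂` the three-index
sums `∑_τ [C₂(τ,τⱼ,τₖ)] g_τ` uniformly in `τⱼ ≠ τₖ` (`C₁, C₂` as in
`TripleAdm.coincidence_of_incompatible`). Then
`∑_τ g_τ D_τ ≤ (F₁K₁ + F₂K₁²)‖ξ_ν‖²`, `K₁ = ∑|κ|²`, `D_τ = ∑_{θ(S), τ∈S ∨ ¬θ(S∪τ)}|c_S|²` — the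
structure of the bounds for `J_𝒞 = X₁ + X₂` ("this term involves two indices … three indices",
then `θ({r_j,v_j}_{j=1}^{m-1}) ≤ θ({r_j,v_j}_{j=1}^{m-2})` resp. `≤ θ(…^{m-3})` to reconstruct `‖ξ_ν‖²`).
[cite: BastiCenatiempoSchlein2021, §5.2 (5.15)–(5.17)] -/
theorem sum_mul_defect_le [Fintype ι] (he : Function.Injective e) (κ : Triple e PH PS → ℂ)
    (g : Triple e PH PS → ℝ) (hg : ∀ τ, 0 ≤ g τ) {F₁ F₂ : ℝ} (hF₁ : 0 ≤ F₁) (hF₂ : 0 ≤ F₂)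
    (hF₁le : ∀ τ' : Triple e PH PS, ∑ τ : Triple e PH PS,
      (if τ.b = τ'.b ∨ (∃ p, (p = τ.u ∨ p = τ.a) ∧ (p = τ'.u ∨ p = τ'.a)) ∨
          (∃ p, (p = τ.u ∨ p = τ.a) ∧ e p + e p + e τ'.b = 0) ∨ (∃ p', (p' = τ'.u ∨ p' = τ'.a) ∧ e p' + e p' + e τ.b = 0)
        then g τ else 0) ≤ F₁)
    (hF₂le : ∀ τj τk : Triple e PH PS, τj ≠ τk → ∑ τ : Triple e PH PS,
      (if (∃ pj pk, (pj = τj.u ∨ pj = τj.a) ∧ (pk = τk.u ∨ pk = τk.a) ∧ e pj + e pk + e τ.b = 0) ∨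
          (∃ p pk, (p = τ.u ∨ p = τ.a) ∧ (pk = τk.u ∨ pk = τk.a) ∧ e p + e pk + e τj.b = 0)
        then g τ else 0) ≤ F₂) :
    ∑ τ : Triple e PH PS, g τ * ∑ S : Finset (Triple e PH PS),
        (if TripleAdm e S ∧ (τ ∈ S ∨ ¬ TripleAdm e (insert τ S)) then ‖setCoeff κ (TripleAdm e) S‖ ^ 2 else 0) ≤
      (F₁ * (∑ τ, ‖κ τ‖ ^ 2) + F₂ * (∑ τ, ‖κ τ‖ ^ 2) ^ 2) *
        ∑ S : Finset (Triple e PH PS), ‖setCoeff κ (TripleAdm e) S‖ ^ 2 := by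
  classical
  set C₁ : Triple e PH PS → Triple e PH PS → Prop := fun τ τ' =>
    τ.b = τ'.b ∨ (∃ p, (p = τ.u ∨ p = τ.a) ∧ (p = τ'.u ∨ p = τ'.a)) ∨
      (∃ p, (p = τ.u ∨ p = τ.a) ∧ e p + e p + e τ'.b = 0) ∨ (∃ p', (p' = τ'.u ∨ p' = τ'.a) ∧ e p' + e p' + e τ.b = 0)
    with hC₁
  set C₂ : Triple e PH PS → Triple e PH PS → Triple e PH PS → Prop := fun τ τj τk =>
    (∃ pj pk, (pj = τj.u ∨ pj = τj.a) ∧ (pk = τk.u ∨ pk = τk.a) ∧ e pj + e pk + e τ.b = 0) ∨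
      (∃ p pk, (p = τ.u ∨ p = τ.a) ∧ (pk = τk.u ∨ pk = τk.a) ∧ e p + e pk + e τj.b = 0) with hC₂
  set c : Finset (Triple e PH PS) → ℝ := fun S => ‖setCoeff κ (TripleAdm e) S‖ ^ 2 with hc
  -- swap the sums
  have hswap : ∑ τ : Triple e PH PS, g τ * ∑ S : Finset (Triple e PH PS),
      (if TripleAdm e S ∧ (τ ∈ S ∨ ¬ TripleAdm e (insert τ S)) then c S else 0) =
      ∑ S : Finset (Triple e PH PS), c S * ∑ τ : Triple e PH PS,
        (if TripleAdm e S ∧ (τ ∈ S ∨ ¬ TripleAdm e (insert τ S)) then g τ else 0) := by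
    simp only [Finset.mul_sum, mul_ite, mul_zero]
    rw [Finset.sum_comm]
    refine Finset.sum_congr rfl fun S _ => Finset.sum_congr rfl fun τ _ => ?_
    split_ifs
    · ring
    · rfl
  rw [hswap]
  -- per-set bound by the coincidence counts
  have hcard0 : ∀ S : Finset (Triple e PH PS), (0 : ℝ) ≤ (S.card : ℝ) * ((S.card : ℝ) - 1) := by
    intro S
    rcases Nat.eq_zero_or_pos S.card with h0 | hpos
    · rw [h0]; simp
    · have : (1 : ℝ) ≤ S.card := by exact_mod_cast hpos
      nlinarith
  have hSle : ∀ S : Finset (Triple e PH PS), ∑ τ : Triple e PH PS,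
      (if TripleAdm e S ∧ (τ ∈ S ∨ ¬ TripleAdm e (insert τ S)) then g τ else 0) ≤
      (S.card : ℝ) * F₁ + (S.card : ℝ) * ((S.card : ℝ) - 1) * F₂ := by
    intro S
    by_cases hA : TripleAdm e S
    · have hpt : ∀ τ : Triple e PH PS, (if TripleAdm e S ∧ (τ ∈ S ∨ ¬ TripleAdm e (insert τ S)) then g τ else 0) ≤
          (∑ τ' ∈ S, (if C₁ τ τ' then g τ else 0)) + ∑ τj ∈ S, ∑ τk ∈ S.erase τj, (if C₂ τ τj τk then g τ else 0) := by
        intro τ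
        have h1 : 0 ≤ ∑ τ' ∈ S, (if C₁ τ τ' then g τ else 0) :=
          Finset.sum_nonneg fun τ' _ => by split_ifs <;> [exact hg τ; exact le_rfl]
        have h2 : 0 ≤ ∑ τj ∈ S, ∑ τk ∈ S.erase τj, (if C₂ τ τj τk then g τ else 0) :=
          Finset.sum_nonneg fun τj _ => Finset.sum_nonneg fun τk _ => by split_ifs <;> [exact hg τ; exact le_rfl]
        split_ifs with h
        · rcases hA.coincidence_of_incompatible he h.2 with ⟨τ', hτ'S, hc1⟩ | ⟨τj, hj, τk, hk, hjk, hc2⟩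
          · have hle : g τ ≤ ∑ τ' ∈ S, (if C₁ τ τ' then g τ else 0) := by
              have := Finset.single_le_sum (f := fun τ' => if C₁ τ τ' then g τ else 0)
                (fun τ' _ => by split_ifs <;> [exact hg τ; exact le_rfl]) hτ'S
              simp only [hC₁, if_pos hc1] at this ⊢
              exact this
            linarith
          · have hle : g τ ≤ ∑ τj ∈ S, ∑ τk ∈ S.erase τj, (if C₂ τ τj τk then g τ else 0) := by
              have hk' : τk ∈ S.erase τj := Finset.mem_erase.2 ⟨hjk.symm, hk⟩
              have i1 := Finset.single_le_sum (f := fun τk => if C₂ τ τj τk then g τ else 0)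
                (fun τk _ => by split_ifs <;> [exact hg τ; exact le_rfl]) hk'
              have i2 := Finset.single_le_sum (f := fun τj => ∑ τk ∈ S.erase τj, (if C₂ τ τj τk then g τ else 0))
                (fun τj _ => Finset.sum_nonneg fun τk _ => by split_ifs <;> [exact hg τ; exact le_rfl]) hj
              simp only [hC₂, if_pos hc2] at i1 i2 ⊢
              exact le_trans i1 i2
            linarith
        · linarith
      calc ∑ τ : Triple e PH PS, (if TripleAdm e S ∧ (τ ∈ S ∨ ¬ TripleAdm e (insert τ S)) then g τ else 0)
          ≤ ∑ τ : Triple e PH PS, ((∑ τ' ∈ S, (if C₁ τ τ' then g τ else 0)) +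
              ∑ τj ∈ S, ∑ τk ∈ S.erase τj, (if C₂ τ τj τk then g τ else 0)) := Finset.sum_le_sum fun τ _ => hpt τ
        _ = (∑ τ' ∈ S, ∑ τ : Triple e PH PS, (if C₁ τ τ' then g τ else 0)) +
              ∑ τj ∈ S, ∑ τk ∈ S.erase τj, ∑ τ : Triple e PH PS, (if C₂ τ τj τk then g τ else 0) := by
            rw [Finset.sum_add_distrib, Finset.sum_comm]
            congr 1
            rw [Finset.sum_comm]
            exact Finset.sum_congr rfl fun τj _ => Finset.sum_comm
        _ ≤ (∑ τ' ∈ S, F₁) + ∑ τj ∈ S, ∑ τk ∈ S.erase τj, F₂ :=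
            add_le_add (Finset.sum_le_sum fun τ' _ => hF₁le τ')
              (Finset.sum_le_sum fun τj _ => Finset.sum_le_sum fun τk hk =>
                hF₂le τj τk (Finset.mem_erase.1 hk).1.symm)
        _ = (S.card : ℝ) * F₁ + (S.card : ℝ) * ((S.card : ℝ) - 1) * F₂ := by
            rw [Finset.sum_const, nsmul_eq_mul]
            rw [Finset.sum_congr rfl fun τj (hj : τj ∈ S) => by
              rw [Finset.sum_const, Finset.card_erase_of_mem hj, nsmul_eq_mul]]
            rw [Finset.sum_const, nsmul_eq_mul]
            rcases Nat.eq_zero_or_pos S.card with h0 | hpos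
            · simp [h0]
            · rw [Nat.cast_sub hpos]; push_cast; ring
    · have h0 : ∑ τ : Triple e PH PS, (if TripleAdm e S ∧ (τ ∈ S ∨ ¬ TripleAdm e (insert τ S)) then g τ else 0) = 0 :=
        Finset.sum_eq_zero fun τ _ => if_neg (fun h => hA h.1)
      rw [h0]
      nlinarith [hcard0 S, Nat.cast_nonneg (α := ℝ) S.card]
  -- sum over `S` and the moment bounds
  have hher : ∀ S : Finset (Triple e PH PS), TripleAdm e S → ∀ τ ∈ S, TripleAdm e (S.erase τ) :=
    fun S hS τ _ => hS.erase τ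
  have hm2 := sum_normSq_setCoeff_mul_card_mul_card_sub_one_le (κ := κ) hher
  have hm1 := sum_normSq_setCoeff_mul_sum_le (κ := κ) hher (fun _ => 1) (fun _ => zero_le_one)
  simp only [one_mul, Finset.sum_const, nsmul_eq_mul, mul_one] at hm1
  calc ∑ S : Finset (Triple e PH PS), c S * ∑ τ : Triple e PH PS,
        (if TripleAdm e S ∧ (τ ∈ S ∨ ¬ TripleAdm e (insert τ S)) then g τ else 0)
      ≤ ∑ S : Finset (Triple e PH PS), c S * ((S.card : ℝ) * F₁ + (S.card : ℝ) * ((S.card : ℝ) - 1) * F₂) :=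
        Finset.sum_le_sum fun S _ => mul_le_mul_of_nonneg_left (hSle S) (sq_nonneg _)
    _ = F₁ * ∑ S : Finset (Triple e PH PS), c S * (S.card : ℝ) +
          F₂ * ∑ S : Finset (Triple e PH PS), c S * ((S.card : ℝ) * ((S.card : ℝ) - 1)) := by
        rw [Finset.mul_sum, Finset.mul_sum, ← Finset.sum_add_distrib]
        exact Finset.sum_congr rfl fun S _ => by ring
    _ ≤ F₁ * ((∑ τ, ‖κ τ‖ ^ 2) * ∑ S : Finset (Triple e PH PS), c S) +
          F₂ * ((∑ τ, ‖κ τ‖ ^ 2) ^ 2 * ∑ S : Finset (Triple e PH PS), c S) :=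
        add_le_add (mul_le_mul_of_nonneg_left hm1 hF₁) (mul_le_mul_of_nonneg_left hm2 hF₂)
    _ = _ := by ring

end Coincidence


end Fock

end Literature.MathematicalPhysics.QuantumManyBody.BoseGas

end
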